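import Mathlib
import Summits.Parity.GeneralizedHardyLittlewood.Theorems.PrimeGapTorusCapPart6
import HarnessLib

/-!
# Prime-gap limit points, the torus cap (cell parity-ideate, p4 ROUND-12) — part 7/8 (`cap_of_cb1` … `volume_midArcSet_inter_Ico`)

Source: `HOME/parity-ideate-p4/round12/Sketch16.lean` (sha16 e5770481db81479a, 7 278 lines, farm rc 0 / 0 sorry /
axioms std-3; namespace `ParityIdeateP4R8`), cut by parity-ideate-lit g32 (`ports/toruscap/build_toruscap.py`) to the
dependency cone (143 declarations) of the eight headline declarations `torusCap_iff`, `torusCapBrauer_iff`,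
`torusCap_half`, `cb1_holds`, `conjHalfStrict_holds`, `NearAP.delannoyNonVanishing_holds`, `capGivesCoverage`,
`residueCoverage_half_of_literature`, in a chain of 8 files of ≤ 400 lines (Theorems-side lint); statements byte-identical
to the source except: `NearAP.P0/P1/P2` are `abbrev` (source: `def` + three `Decidable` instances, dropped per the typing
lint), examples and `decide` rungs outside the cone dropped, namespace `ParityIdeateP4R8` ↦ `Summit.Parity.GeneralizedHardyLittlewood.Theorems.PrimeGapTorusCap`.
Non-Mathlib inputs: `Literature.Combinatorics.Additive.ErdosHeilbronn` (combinatorial Nullstellensatz),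
`Literature.NumberTheory.Sieve.PrimeGapLimitPoints` (`primeGapLimitSet`, `HasPointProperty`, the NAMED fact
`Merikoski2020_theorem1`, used hypothesis-style, never asserted).  No `sorry`, no new axioms, no `instance`, no notation.
Cell-original mathematics (FRONTIER formalisation; nothing here bears on the parity problem beyond the typed statements):
CONJECTURE C of the cell = every measurable `perℤ`-periodic four-point-free `U ⊆ ℝ` has `μ(U ∩ [0,per)) ≤ per/2`,
sharp (mid arc); pay-off: residues of the prime-gap limit-point set `𝓛` modulo `λ` cover ≥ half of `[0, λ)` for every
`λ > 0`, given Merikoski's four-point theorem. HEADLINE DECLS IN THIS PART: `torusCapBrauer_half`, `torusCap_half`, `residueCoverage_half_of_literature`.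
-/

namespace Summit.Parity.GeneralizedHardyLittlewood.Theorems.PrimeGapTorusCap
open MeasureTheory Set Filter Topology NearAP

/-- Rescaling a `per`-periodic Brauer-free set to period `1` (`W = per⁻¹·U`), `C_B` at period 1 gives the cap at period `per`. -/
theorem cap_of_cb1 (h : CB1) {per : ℝ} (hper : 0 < per) {U : Set ℝ} (hU : MeasurableSet U)
    (hperU : ∀ t ∈ U, ∀ n : ℤ, t + n * per ∈ U) (hB : BrauerFree U) :
    volume (U ∩ Set.Ico 0 per) ≤ ENNReal.ofReal (1 / 2 * per) := by
  set W : Set ℝ := (fun x => per * x) ⁻¹' U with hW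
  have hWm : MeasurableSet W := hU.preimage (measurable_const_mul per)
  have hWP : Periodic1 W := by
    intro t ht n
    show per * (t + n) ∈ U
    have := hperU (per * t) ht n
    convert this using 1; ring
  have hWB : BrauerFree W := by
    intro d x hd hx hxd hx2d
    refine hB (per * d) (per * x) hd hx ?_ ?_
    · have : per * (x + d) ∈ U := hxd
      convert this using 1; ring
    · have : per * (x + 2 * d) ∈ U := hx2d
      convert this using 1; ring
  have hcap := h W hWm hWP hWB
  have hpre : W ∩ Set.Ico (0 : ℝ) 1 = (fun x => per * x) ⁻¹' (U ∩ Set.Ico 0 per) := by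
    ext x
    simp only [hW, Set.mem_inter_iff, Set.mem_preimage, Set.mem_Ico]
    constructor
    · rintro ⟨hx, h0, h1⟩
      exact ⟨hx, by positivity, by nlinarith⟩
    · rintro ⟨hx, h0, h1⟩
      refine ⟨hx, ?_, ?_⟩
      · by_contra hneg
        push Not at hneg
        nlinarith
      · by_contra hge
        push Not at hge
        nlinarith
  rw [hpre, Real.volume_preimage_mul_left hper.ne', abs_of_pos (inv_pos.2 hper)] at hcap
  calc volume (U ∩ Set.Ico 0 per)
      = ENNReal.ofReal per * (ENNReal.ofReal per⁻¹ * volume (U ∩ Set.Ico 0 per)) := by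
        rw [← mul_assoc, ← ENNReal.ofReal_mul hper.le, mul_inv_cancel₀ hper.ne', ENNReal.ofReal_one, one_mul]
    _ ≤ ENNReal.ofReal per * ENNReal.ofReal (1 / 2) := by gcongr
    _ = ENNReal.ofReal (1 / 2 * per) := by rw [← ENNReal.ofReal_mul hper.le, mul_comm]

/-- **CONJECTURE C_B IS A THEOREM: `σ_B = 1/2`.**  Every Brauer-free measurable `perℤ`-periodic set has measure `≤ per/2` per period. -/
theorem torusCapBrauer_half : TorusCapBrauer (1 / 2) :=
  fun _ hper _ hU hperU hB => cap_of_cb1 cb1_holds hper hU hperU hB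

/-- **CONJECTURE C IS A THEOREM: `σ₄ = 1/2`.**  Every 4-point-free measurable `perℤ`-periodic set of reals has measure `≤ per/2`
per period (tight: the mid arc `(per/4, 3per/4) + perℤ`, Sketch7 / parity-ideate-lit `fourPointFree_midArcSet`). -/
theorem torusCap_half : TorusCap (1 / 2) := torusCap_of_torusCapBrauer torusCapBrauer_half

end Summit.Parity.GeneralizedHardyLittlewood.Theorems.PrimeGapTorusCap
/-! ## §AP (ROUND-12) THE PARITY PAY-OFF: residues of `𝓛` modulo `λ` cover at least HALF of `[0, λ)`, for every `λ > 0`.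

The conversion edge `capGivesCoverage_of_nonneg : TorusCap σ → MerikoskiFourPoint → ResidueCoverage (1 - σ)` and everything below up to
`end EndToEnd` is copied VERBATIM from parity-ideate-lit g24's kernel file `HOME/parity-ideate-lit/KneserAmplifier_kernel.lean` (sha16 ad58d439b6bf4af4,
lines 310–428 and 601–616; there in namespace `ParityIdeateLitG24`, here in `Summit.Parity.GeneralizedHardyLittlewood.Theorems.PrimeGapTorusCap`, whose `FourPointFree`/`TorusCap` have the same bodies),
minus the two corollaries that need g24's circle theorems (`residueCoverage_four_ninths`, `residueCoverage_two_fifths`, and `…_of_literature`).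
NEW: `residueCoverage_half`, `residueCoverage_half_of_literature` — with `σ₄ = 1/2` the method's coverage constant is `1/2`, and this is the
ceiling of the cap method (the mid arc). -/

namespace Summit.Parity.GeneralizedHardyLittlewood.Theorems.PrimeGapTorusCap
open MeasureTheory Set Filter Topology Metric
open scoped Pointwise ENNReal
section Coverage
/-- Sketch3:25 verbatim. -/
noncomputable def normGap (n : ℕ) : ℝ :=
  ((Nat.nth Nat.Prime (n + 1) : ℝ) - (Nat.nth Nat.Prime n : ℝ)) / Real.log (Nat.nth Nat.Prime n)

/-- Sketch3:31 verbatim. -/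
def gapLimitSet : Set ℝ := {β | MapClusterPt β atTop normGap}

/-- Sketch3:41 verbatim. -/
def FourPoint (B : Set ℝ) : Prop :=
  ∀ β₁ β₂ β₃ β₄ : ℝ, 0 ≤ β₁ → β₁ ≤ β₂ → β₂ ≤ β₃ → β₃ ≤ β₄ →
    (β₂ - β₁ ∈ B ∨ β₃ - β₁ ∈ B ∨ β₄ - β₁ ∈ B ∨ β₃ - β₂ ∈ B ∨ β₄ - β₂ ∈ B ∨ β₄ - β₃ ∈ B)

/-- Sketch3:47 verbatim. -/
def MerikoskiFourPoint : Prop := FourPoint gapLimitSet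

/-- Sketch3:89 verbatim. -/
def residueAvoiders (B : Set ℝ) (per : ℝ) : Set ℝ := {t | ∀ m : ℤ, t + m * per ∉ B}

/-- Sketch3:155 verbatim. -/
def ResidueCoverage (c : ℝ) : Prop :=
  ∀ per : ℝ, 0 < per → ENNReal.ofReal (c * per) ≤ volume (Set.Ico 0 per \ residueAvoiders gapLimitSet per)

/-- Sketch3:160 verbatim. -/
def CapGivesCoverage : Prop := ∀ σ : ℝ, TorusCap σ → MerikoskiFourPoint → ResidueCoverage (1 - σ)

/-- (cell parity-ideate p4, Sketch16 — helper; statement verbatim) -/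
theorem residueAvoiders_add_int_mul {B : Set ℝ} {per t : ℝ} (ht : t ∈ residueAvoiders B per) (n : ℤ) :
    t + n * per ∈ residueAvoiders B per := by
  intro m
  have := ht (n + m)
  simpa [Int.cast_add, add_mul, add_assoc] using this

/-- (cell parity-ideate p4, Sketch16 — helper; statement verbatim) -/
theorem exists_pos_add_int_mul {per : ℝ} (hper : 0 < per) (t : ℝ) : ∃ n : ℤ, 0 < t + n * per := by
  obtain ⟨n, hn⟩ := exists_nat_gt (-t / per)
  refine ⟨n, ?_⟩
  have : -t < n * per := by
    have := (div_lt_iff₀ hper).1 hn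
    simpa using this
  push_cast
  linarith

/-- p4's kernel lemma (Sketch3:108), verbatim. -/
theorem fourPointFree_residueAvoiders {B : Set ℝ} (h : FourPoint B) {per : ℝ} (hper : 0 < per) :
    FourPointFree (residueAvoiders B per) := by
  intro x y z hx hy hz hxy hyz hxyz
  obtain ⟨a, ha⟩ := exists_pos_add_int_mul hper x
  obtain ⟨b, hb⟩ := exists_pos_add_int_mul hper y
  obtain ⟨c, hc⟩ := exists_pos_add_int_mul hper z
  set x' := x + a * per with hx'
  set y' := y + b * per with hy'
  set z' := z + c * per with hz'
  have kx : x' ∈ residueAvoiders B per := residueAvoiders_add_int_mul hx a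
  have ky : y' ∈ residueAvoiders B per := residueAvoiders_add_int_mul hy b
  have kz : z' ∈ residueAvoiders B per := residueAvoiders_add_int_mul hz c
  have kxy : x' + y' ∈ residueAvoiders B per := by
    have := residueAvoiders_add_int_mul hxy (a + b)
    simpa [hx', hy', Int.cast_add, add_mul, add_assoc, add_left_comm, add_comm] using this
  have kyz : y' + z' ∈ residueAvoiders B per := by
    have := residueAvoiders_add_int_mul hyz (b + c)
    simpa [hy', hz', Int.cast_add, add_mul, add_assoc, add_left_comm, add_comm] using this
  have kxyz : x' + y' + z' ∈ residueAvoiders B per := by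
    have := residueAvoiders_add_int_mul hxyz (a + b + c)
    simpa [hx', hy', hz', Int.cast_add, add_mul, add_assoc, add_left_comm, add_comm] using this
  have mem0 : ∀ {t : ℝ}, t ∈ residueAvoiders B per → t ∉ B := fun ht => by simpa using ht 0
  rcases h 0 x' (x' + y') (x' + y' + z') le_rfl ha.le (by linarith) (by linarith) with k | k | k | k | k | k
  · exact mem0 kx (by simpa using k)
  · exact mem0 kxy (by simpa using k)
  · exact mem0 kxyz (by simpa using k)
  · exact mem0 ky (by simpa using k)
  · exact mem0 kyz (by simpa [show x' + y' + z' - x' = y' + z' by ring] using k)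
  · exact mem0 kz (by simpa [show x' + y' + z' - (x' + y') = z' by ring] using k)

/-- `𝓛` is closed (a cluster-point set). -/
theorem isClosed_gapLimitSet : IsClosed gapLimitSet := isClosed_setOf_clusterPt

/-- The residue-avoiding set of a closed set is measurable (a countable intersection of translates of
the complement). -/
theorem measurableSet_residueAvoiders {B : Set ℝ} (hB : MeasurableSet B) (per : ℝ) :
    MeasurableSet (residueAvoiders B per) := by
  have : residueAvoiders B per = ⋂ m : ℤ, (fun t : ℝ => t + m * per) ⁻¹' Bᶜ := by
    ext t
    simp [residueAvoiders]
  rw [this]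
  exact MeasurableSet.iInter fun m => (measurable_add_const _) hB.compl

/-- **T4-B, the conversion edge: cap `σ` ⇒ coverage `1 − σ`**, for every `σ ≥ 0` (for `σ < 0` the
hypothesis `TorusCap σ` is false — e.g. by the mid-arc example — and p4's unrestricted `CapGivesCoverage`
holds vacuously there; that vacuity is not formalised here). -/
theorem capGivesCoverage_of_nonneg (σ : ℝ) (hσ : 0 ≤ σ) (hcap : TorusCap σ) (hM : MerikoskiFourPoint) :
    ResidueCoverage (1 - σ) := by
  intro per hper
  set U := residueAvoiders gapLimitSet per with hU
  have hUm : MeasurableSet U := measurableSet_residueAvoiders isClosed_gapLimitSet.measurableSet per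
  have hperU : ∀ t ∈ U, ∀ n : ℤ, t + n * per ∈ U := fun t ht n => residueAvoiders_add_int_mul ht n
  have h4 : FourPointFree U := fourPointFree_residueAvoiders hM hper
  have hcapU : volume (U ∩ Set.Ico 0 per) ≤ ENNReal.ofReal (σ * per) := hcap per hper U hUm hperU h4
  -- pass to real numbers inside the period `[0, per)`
  have hIco : volume (Set.Ico (0 : ℝ) per) = ENNReal.ofReal per := by
    rw [Real.volume_Ico, sub_zero]
  have hfinI : volume (Set.Ico (0 : ℝ) per) ≠ ⊤ := by rw [hIco]; exact ENNReal.ofReal_ne_top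
  have hsub : U ∩ Set.Ico 0 per ⊆ Set.Ico 0 per := Set.inter_subset_right
  have hfinU : volume (U ∩ Set.Ico 0 per) ≠ ⊤ := measure_ne_top_of_subset hsub hfinI
  have hdiff : Set.Ico 0 per \ U = Set.Ico 0 per \ (U ∩ Set.Ico 0 per) := by
    ext t
    simp only [Set.mem_sdiff, Set.mem_inter_iff]
    tauto
  have hfinD : volume (Set.Ico 0 per \ U) ≠ ⊤ := measure_ne_top_of_subset Set.sdiff_subset hfinI
  have hreal : volume.real (Set.Ico 0 per \ U) = per - volume.real (U ∩ Set.Ico 0 per) := by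
    rw [hdiff, measureReal_sdiff hsub (hUm.inter measurableSet_Ico)]
    · rw [measureReal_def, hIco, ENNReal.toReal_ofReal hper.le]
  have hcapR : volume.real (U ∩ Set.Ico 0 per) ≤ σ * per := by
    rw [measureReal_def]
    exact ((ENNReal.toReal_le_toReal hfinU ENNReal.ofReal_ne_top).2 hcapU).trans_eq
      (ENNReal.toReal_ofReal (mul_nonneg hσ hper.le))
  rw [← ofReal_measureReal hfinD]
  apply ENNReal.ofReal_le_ofReal
  rw [hreal]
  linarith

/-- **COROLLARY B″ (ROUND-12): coverage ONE HALF.**  Under Merikoski's four-point property of `𝓛`, for every `λ > 0` the residues of `𝓛`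
modulo `λ` cover at least `λ/2` of `[0, λ)` — from CONJECTURE C now proved (`torusCap_half`). -/
theorem residueCoverage_half (hM : MerikoskiFourPoint) : ResidueCoverage (1 / 2) := by
  have h := capGivesCoverage_of_nonneg (1 / 2) (by norm_num) torusCap_half hM
  norm_num at h
  exact h

end Coverage
/-! ## End-to-end: the cited Literature fact `Merikoski2020_theorem1` ⇒ Corollary B′ -/

section EndToEnd
/-- The tree's named fact gives the cell's hypothesis shape. -/
theorem merikoskiFourPoint_of_literature (h : Literature.NumberTheory.Sieve.Merikoski2020_theorem1) :
    MerikoskiFourPoint :=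
  fun β₁ β₂ β₃ β₄ h0 h12 h23 h34 =>
    Literature.NumberTheory.Sieve.Merikoski2020_theorem1.fourPoint_nonneg h β₁ β₂ β₃ β₄ h0 h12 h23 h34

/-- **COROLLARY B″ from ONE cited Literature fact**: Merikoski 2020 Thm 1 ⇒ for every `λ > 0` the residues of `𝓛` modulo `λ` cover
at least `λ/2` of `[0, λ)`; everything between (Conjecture C included) is kernel-checked. -/
theorem residueCoverage_half_of_literature
    (h : Literature.NumberTheory.Sieve.Merikoski2020_theorem1) : ResidueCoverage (1 / 2) :=
  residueCoverage_half (merikoskiFourPoint_of_literature h)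

end EndToEnd
/-! ## The mid-arc example: `σ₄ ≥ 1/2` in the kernel, and p4's `CapGivesCoverage` for every `σ`

`midArcSet per = (per/4, 3per/4) + perℤ` is measurable, `perℤ`-periodic, 4-point-free (ROUND-3 §2(2) desk
lemma: write `x ≡ per/2 + a`, `|a| < per/4`, …) and has exactly half of each period; hence `TorusCap σ → 1/2 ≤ σ`,
which also makes `CapGivesCoverage` hold for `σ < 0` (vacuously). -/

section MidArc
/-- The mid-arc set `(per/4, 3per/4) + perℤ`, written through centred representatives. -/
def midArcSet (per : ℝ) : Set ℝ := {t | ∃ k : ℤ, |t - per / 2 - k * per| < per / 4}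

/-- (cell parity-ideate p4, Sketch16 — helper; statement verbatim) -/
theorem midArcSet_periodic {per : ℝ} {t : ℝ} (ht : t ∈ midArcSet per) (n : ℤ) :
    t + n * per ∈ midArcSet per := by
  obtain ⟨k, hk⟩ := ht
  refine ⟨k + n, ?_⟩
  push_cast
  have : t + n * per - per / 2 - (k + n) * per = t - per / 2 - k * per := by ring
  rw [this]
  exact hk

/-- (cell parity-ideate p4, Sketch16 — helper; statement verbatim) -/
theorem measurableSet_midArcSet (per : ℝ) : MeasurableSet (midArcSet per) := by
  have : midArcSet per = ⋃ k : ℤ, (fun t : ℝ => t - per / 2 - k * per) ⁻¹' Metric.ball 0 (per / 4) := by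
    ext t
    simp [midArcSet, Metric.mem_ball]
  rw [this]
  exact MeasurableSet.iUnion fun k => (by fun_prop : Measurable fun t : ℝ => t - per / 2 - k * per)
    measurableSet_ball

/-- Integer squeezing: if `|w - n·per| < per/4 + slack` style bounds pin `n`. Auxiliary: an integer with
`-(5/4) < n < 1/4` is `-1` or `0`. -/
private theorem int_cases_aux {n : ℤ} {per : ℝ} (hper : 0 < per) (h1 : (n : ℝ) * per < per / 4)
    (h2 : -(5 * per / 4) < (n : ℝ) * per) : n = -1 ∨ n = 0 := by
  have hn1 : (n : ℝ) < 1 := by nlinarith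
  have hn2 : (-2 : ℝ) < n := by nlinarith
  have hn1' : n < 1 := by exact_mod_cast hn1
  have hn2' : -2 < n := by exact_mod_cast hn2
  omega

/-- (cell parity-ideate p4, Sketch16 — helper; statement verbatim) -/
private theorem int_eq_zero_aux {n : ℤ} {per : ℝ} (hper : 0 < per) (h1 : (n : ℝ) * per < per)
    (h2 : -per < (n : ℝ) * per) : n = 0 := by
  have hn1 : (n : ℝ) < 1 := by nlinarith
  have hn2 : (-1 : ℝ) < n := by nlinarith
  have hn1' : n < 1 := by exact_mod_cast hn1
  have hn2' : -1 < n := by exact_mod_cast hn2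
  omega

/-- Membership of a sum of two centred representatives: for `|a|, |b| < per/4`,
`per/2 + a + kper + (per/2 + b + lper) ∈ midArcSet ⇒ |a + b| > per/4`. -/
private theorem midArc_add_two {per a b : ℝ} (hper : 0 < per) (ha : |a| < per / 4) (hb : |b| < per / 4)
    {k l : ℤ} (h : per / 2 + a + k * per + (per / 2 + b + l * per) ∈ midArcSet per) :
    per / 4 < |a + b| := by
  obtain ⟨m, hm⟩ := h
  -- the quantity is `a + b + (k + l + 1) per - per/2 - m per = a + b - per/2 - n per`, `n = m - k - l - 1`
  have e : per / 2 + a + k * per + (per / 2 + b + l * per) - per / 2 - m * per =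
      a + b - per / 2 - ((m - k - l - 1 : ℤ) : ℝ) * per := by push_cast; ring
  rw [e] at hm
  set n : ℤ := m - k - l - 1 with hn
  have hab : |a + b| < per / 2 := by
    calc |a + b| ≤ |a| + |b| := abs_add_le _ _
      _ < per / 4 + per / 4 := add_lt_add ha hb
      _ = per / 2 := by ring
  rw [abs_lt] at hm hab ha hb
  have h1 : (n : ℝ) * per < per / 4 := by linarith [hm.1, hm.2, hab.1, hab.2]
  have h2 : -(5 * per / 4) < (n : ℝ) * per := by linarith [hm.1, hm.2, hab.1, hab.2]
  rcases int_cases_aux hper h1 h2 with hn' | hn'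
  · rw [hn'] at hm; push_cast at hm
    rw [lt_abs]; right; linarith [hm.1, hm.2]
  · rw [hn'] at hm; push_cast at hm
    rw [lt_abs]; left; linarith [hm.1, hm.2]

/-- Membership of a sum of three centred representatives: `|a + b + c| < per/4`. -/
private theorem midArc_add_three {per a b c : ℝ} (hper : 0 < per) (ha : |a| < per / 4)
    (hb : |b| < per / 4) (hc : |c| < per / 4) {k l j : ℤ}
    (h : per / 2 + a + k * per + (per / 2 + b + l * per) + (per / 2 + c + j * per) ∈ midArcSet per) :
    |a + b + c| < per / 4 := by
  obtain ⟨m, hm⟩ := h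
  have e : per / 2 + a + k * per + (per / 2 + b + l * per) + (per / 2 + c + j * per) - per / 2 - m * per =
      a + b + c - ((m - k - l - j - 1 : ℤ) : ℝ) * per := by push_cast; ring
  rw [e] at hm
  set n : ℤ := m - k - l - j - 1 with hn
  have habc : |a + b + c| < 3 * per / 4 := by
    calc |a + b + c| ≤ |a + b| + |c| := abs_add_le _ _
      _ ≤ |a| + |b| + |c| := by gcongr; exact abs_add_le _ _
      _ < per / 4 + per / 4 + per / 4 := by gcongr
      _ = 3 * per / 4 := by ring
  rw [abs_lt] at hm habc
  have h1 : (n : ℝ) * per < per := by linarith [hm.1, hm.2, habc.1, habc.2]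
  have h2 : -per < (n : ℝ) * per := by linarith [hm.1, hm.2, habc.1, habc.2]
  have hn0 := int_eq_zero_aux hper h1 h2
  rw [hn0] at hm; push_cast at hm
  rw [abs_lt]; constructor <;> linarith [hm.1, hm.2]

/-- Centred representative of a member: `t = per/2 + a + k per` with `|a| < per/4`. -/
private theorem midArc_repr {per t : ℝ} (ht : t ∈ midArcSet per) :
    ∃ (a : ℝ) (k : ℤ), |a| < per / 4 ∧ t = per / 2 + a + k * per := by
  obtain ⟨k, hk⟩ := ht
  exact ⟨t - per / 2 - k * per, k, hk, by ring⟩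

/-- **The mid-arc set is 4-point-free** (ROUND-3 §2(2), the lower-bound example `σ₄ ≥ 1/2`). -/
theorem fourPointFree_midArcSet {per : ℝ} (hper : 0 < per) : FourPointFree (midArcSet per) := by
  intro x y z hx hy hz hxy hyz hxyz
  obtain ⟨a, k, ha, rfl⟩ := midArc_repr hx
  obtain ⟨b, l, hb, rfl⟩ := midArc_repr hy
  obtain ⟨c, j, hc, rfl⟩ := midArc_repr hz
  have hab := midArc_add_two hper ha hb hxy
  have hbc := midArc_add_two hper hb hc hyz
  have habc := midArc_add_three hper ha hb hc hxyz
  rw [abs_lt] at ha hb hc habc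
  rw [lt_abs] at hab hbc
  rcases hab with hab | hab <;> rcases hbc with hbc | hbc <;>
    first | linarith [habc.1, habc.2, ha.1, ha.2, hb.1, hb.2, hc.1, hc.2]

/-- Inside one period the mid-arc set is the open interval `(per/4, 3per/4)`. -/
theorem midArcSet_inter_Ico {per : ℝ} (hper : 0 < per) :
    midArcSet per ∩ Set.Ico 0 per = Set.Ioo (per / 4) (3 * per / 4) := by
  ext t
  simp only [Set.mem_inter_iff, Set.mem_Ico, Set.mem_Ioo, midArcSet, Set.mem_setOf_eq]
  constructor
  · rintro ⟨⟨k, hk⟩, ht0, ht1⟩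
    rw [abs_lt] at hk
    have h1 : (k : ℝ) * per < per := by linarith
    have h2 : -per < (k : ℝ) * per := by linarith
    have hk0 := int_eq_zero_aux hper h1 h2
    rw [hk0] at hk; push_cast at hk
    constructor <;> linarith [hk.1, hk.2]
  · rintro ⟨h1, h2⟩
    refine ⟨⟨0, ?_⟩, by linarith, by linarith⟩
    push_cast
    rw [abs_lt]; constructor <;> linarith

/-- The mid-arc set has exactly half of each period. -/
theorem volume_midArcSet_inter_Ico {per : ℝ} (hper : 0 < per) :
    volume (midArcSet per ∩ Set.Ico 0 per) = ENNReal.ofReal (per / 2) := by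
  rw [midArcSet_inter_Ico hper, Real.volume_Ioo]
  congr 1
  ring

end MidArc
end Summit.Parity.GeneralizedHardyLittlewood.Theorems.PrimeGapTorusCap
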